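import Summits.QuantumFields.BalabanUV.Beta.FP.MixLoopInstanceBlockFamily
import Summits.QuantumFields.BalabanUV.Beta.FP.SymmetryK

/-!
# `BalabanUV.Beta.FP.PerfectColumnLettersColH` — road «FP» for binder row D1, ROW KER-γ (LEDGER), the common column adapter (A1) (leaf-05-g15's
# `ALPHA2C-STATEMENT.md` §4; `KER-GAMMA-ALPHA2.md` §0∕§3 (β)): THE COLUMN LETTERS (J)(J′) OF THE PERFECT RESOLVENT IN THE JUNCTION's `colH` CURRENCY —
# VERBATIM the `hJ`∕`hJ'` binders of F `FineSplitJunctionTwoLeg.rem_of_twoLeg` (hence of `BlockTermsPieces.ledger_mixPiece_*`, `WindowedWordLedger.ledger_window_*`,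
# leaf-05's F′ `rem_of_majorant`) at `K := KPerf Lc (sfStep Lc) (smStep 3 Lc) m`, `N := Lc^m`, from (β)'s lattice-unit letters
# `MixLoopInstanceBlockFamily.latticeColumn_engineLetters` (`J_m := N⁴•colOf (KPerf … m)`: sup `C·N⁻¹·e^{−(κ₀∕4∕N)‖·‖∞}`, coarse moment `C·N⁻¹·(…)`)

HONEST DEPENDENCY (page 1, mandatory): continuum YM on T⁴ ⇐ BetaPertH ∧ nine spine estimates (0/9 proved); BetaPertH ⇐ (D1) ∧ (D4) ∧
CAP+tail; G-an2-4 gates asym, D1 and NE2/3/4.  HONEST FRAMING (cell contract, verbatim): «discharging `BetaPertH` makes Bałaban's UV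
stability UNCONDITIONAL — a real constructive-QFT result; it is NOT the continuum limit and NOT the Clay problem.»  THIS MODULE is [folklore]
bookkeeping BY NAME: the column identity `colH K N b u e x = colOf K e b (N•u − x)` under block covariance (`SymmetryK.shiftK_KPerf` for the perfect
resolvent), the `N⁴` rescaling of (β) (`PerfectColumnLatticeUnits`), and `latticeColumn_engineLetters`.  No `def`, no `def … : Prop`, nothing cited, nothing
of the manuscripts under audit asserted, 0 sorry.  The N-powers are DISPLAYED (`C·N⁻¹·N⁻⁴` per column): their balance against the pieces' `E₀` and the window
letters' `N⁴·N⁴` is the (γ)∕(LEDGER) arithmetic, decided by nobody here.  NOT (LEDGER)'s numbers, NOT hsplit, NOT (ASYMP), NOT D1; 0∕4 row-D1 binders; NOT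
BetaPertH, NOT continuum, NOT Clay.  «not in print; our bookkeeping».

ABSOLUTE RULE (cell charter, verbatim): «No internally-minted statement may enter as a cited fact. Every hypothesis is either kernel-proved in this
package or a verbatim quotation of a PUBLISHED theorem with page reference. The manuscript(s) under audit are NOT citable for their own disputed
steps — they are the thing under adjudication; programme-internal (2001/route/tribunal) claims are never citable.»

CONTENT ([folklore]).
* §1 `colH_eq_colOf_of_cov` (any `N`-block covariant packed kernel on `ℤ⁴`), `abs_colOf_eq_of_smul` (the `N⁴` rescaling, `0 < N`).
* §2 **`columnLetters_colH`**: `2 ≤ Lc` ⟹ `∃ δ₁ > 0, ∃ C ≥ 0, ∀ m ≥ 1`, with `N := Lc^m`: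
  (J)  `∀ a c p, |colH (KPerf…m) N a 0 c p| ≤ (C·N⁻¹·(N⁴)⁻¹)·e^{−(δ₁∕N)‖p − N•0‖∞}`;
  (J′) `∀ b e S′ x, Σ_{u∈S′}(1 + (‖x − N•u‖∞∕N)²)·|colH (KPerf…m) N b u e x| ≤ C·N⁻¹·(N⁴)⁻¹·((1 + 16∕δ₁²)·(e^{δ₁∕2}·(1 + 480·e^{δ₁∕4}·(2∕(δ₁∕2))⁴)))`
  — so every ledger END of the junction (`rem_of_twoLeg`, `ledger_mixPiece_*`, `ledger_window_*`, `rem_of_majorant`) is instantiated at the perfect columns with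
  `C_J := C·N⁻¹·(N⁴)⁻¹`, `δ := δ₁` and `C_J′ :=` the displayed product.
Provenance: D1 formalisation swarm LEAF PROVER 01, unit `b2b-balaban-beta-d1-formalise-leaf-01` gen 12, 2026-08-21, road FP row KER-γ (LEDGER) adapter (A1).
-/

noncomputable section

namespace Summit.QuantumFields.BalabanUV.Beta.FP.PerfectColumnLettersColH

open Finset
open scoped BigOperators
open Literature.MathematicalPhysics.QuantumFieldTheory.Balaban1983to89
open Literature.MathematicalPhysics.QuantumFieldTheory.Balaban1983to89.Beta
open ExpKernelCalculus (Site MKer shiftK)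
open OneStepResolventKernel (Fib)
open OneStepKernelFamily (colH)
open DyadicShell (Pt supNorm)
open Summit.QuantumFields.BalabanUV.Beta.GAN24.CombesThomas (sfStep smStep)
open Summit.QuantumFields.BalabanUV.Beta.FP.PerfectObjectsT (KPerf)
open Summit.QuantumFields.BalabanUV.Beta.FP.TransportInfinityM (colOf colOf_apply)
open Summit.QuantumFields.BalabanUV.Beta.FP.SymmetryK (shiftK_KPerf)
open Summit.QuantumFields.BalabanUV.Beta.FP.MixLoopInstanceBlockFamily (latticeColumn_engineLetters)

/-! ## §1 The column identity under block covariance and the `N⁴` rescaling -/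

/-- [folklore] **THE JUNCTION's COLUMN IS THE END's COLUMN**: for an `N`-block covariant packed kernel on `ℤ⁴`,
`colH K N b u e x = colOf K e b (N•u − x)` (both read the `(field e at x, multiplier b at the coarse point u)` entry). -/
theorem colH_eq_colOf_of_cov {K : MKer (3 + 1) (Fib 3)} {N : ℕ} (hK : ∀ t : Fin (3 + 1) → ℤ, shiftK (-((N : ℤ) • t)) K = K)
    (b : Fin 4) (u : Pt) (e : Fin 4) (x : Pt) :
    colH K N b u e x = colOf K e b ((N : ℤ) • u - x) := by
  rw [colOf_apply]
  unfold colH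
  conv_lhs => rw [← hK u]
  simp only [shiftK, sub_eq_add_neg, add_neg_cancel]
  congr 1
  abel

/-- [folklore] reading an entry of `colOf K` off the rescaled column family `N⁴•colOf K` (`0 < N`). -/
theorem abs_colOf_eq_of_smul (K : MKer (3 + 1) (Fib 3)) {N : ℝ} (hN : 0 < N) (κ l : Fin 4) (p : Pt) :
    |colOf K κ l p| = (N ^ 4)⁻¹ * |((N ^ 4) • colOf K) κ l p| := by
  have h4 : 0 < N ^ 4 := by positivity
  simp only [Pi.smul_apply, smul_eq_mul, abs_mul, abs_of_pos h4]
  field_simp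

/-! ## §2 The letters (J)(J′) at the perfect resolvent, `colH` currency -/

variable {Lc : ℕ} [NeZero Lc]

/-- **THE COLUMN LETTERS OF THE PERFECT RESOLVENT IN THE JUNCTION's CURRENCY** [folklore]: `2 ≤ Lc` ⟹ `∃ δ₁ > 0, ∃ C ≥ 0` such that for every `m ≥ 1`
(`N := Lc^m`, `K := KPerf Lc (sfStep Lc) (smStep 3 Lc) m`) the two binders of `FineSplitJunctionTwoLeg.rem_of_twoLeg` hold with
`C_J := C·N⁻¹·(N⁴)⁻¹`, rate `δ₁` (anchor `0`) and `C_J′ := C·N⁻¹·(N⁴)⁻¹·((1 + 16∕δ₁²)·(e^{δ₁∕2}·(1 + 480·e^{δ₁∕4}·(2∕(δ₁∕2))⁴)))` —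
`latticeColumn_engineLetters` ((β), `J_m = N⁴•colOf`) read through `colH_eq_colOf_of_cov` + `shiftK_KPerf`. -/
theorem columnLetters_colH (hLc : 2 ≤ Lc) : ∃ δ₁ C : ℝ, 0 < δ₁ ∧ 0 ≤ C ∧ ∀ m : ℕ, 1 ≤ m →
    (∀ (a c : Fin 4) (p : Pt),
      |colH (KPerf (d := 3) Lc (sfStep Lc) (smStep 3 Lc) m) (Lc ^ m) a 0 c p|
        ≤ (C * (((Lc ^ m : ℕ) : ℝ))⁻¹ * ((((Lc ^ m : ℕ) : ℝ)) ^ 4)⁻¹)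
            * Real.exp (-(δ₁ / ((Lc ^ m : ℕ) : ℝ)) * (supNorm (p - ((Lc ^ m : ℕ) : ℤ) • (0 : Pt)) : ℝ))) ∧
    (∀ (b e : Fin 4) (S' : Finset Pt) (x : Pt),
      ∑ u ∈ S', (1 + ((supNorm (x - ((Lc ^ m : ℕ) : ℤ) • u) : ℝ) / ((Lc ^ m : ℕ) : ℝ)) ^ 2)
          * |colH (KPerf (d := 3) Lc (sfStep Lc) (smStep 3 Lc) m) (Lc ^ m) b u e x|
        ≤ C * (((Lc ^ m : ℕ) : ℝ))⁻¹ * ((((Lc ^ m : ℕ) : ℝ)) ^ 4)⁻¹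
            * ((1 + 16 / δ₁ ^ 2) * (Real.exp (δ₁ / 2) * (1 + 480 * Real.exp (δ₁ / 2 / 2) * (2 / (δ₁ / 2)) ^ 4)))) := by
  obtain ⟨κ₀, C, hκ₀, hC, h⟩ := latticeColumn_engineLetters (Lc := Lc) hLc
  refine ⟨κ₀ / 4, C, by positivity, hC, fun m hm => ?_⟩
  have hκl := h m hm
  set N : ℕ := Lc ^ m with hNdef
  have hN1 : 1 ≤ N := Nat.one_le_pow _ _ (by omega)
  have hNpos : (0 : ℝ) < (N : ℝ) := by exact_mod_cast hN1
  have hcov : ∀ t : Fin (3 + 1) → ℤ, shiftK (-((N : ℤ) • t)) (KPerf (d := 3) Lc (sfStep Lc) (smStep 3 Lc) m) = KPerf Lc (sfStep Lc) (smStep 3 Lc) m :=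
    fun t => shiftK_KPerf Lc (sfStep Lc) (smStep 3 Lc) m t
  refine ⟨fun a c p => ?_, fun b e S' x => ?_⟩
  · rw [colH_eq_colOf_of_cov hcov, abs_colOf_eq_of_smul _ hNpos]
    have h1 := (hκl c a).1 p 0
    calc (((N : ℕ) : ℝ) ^ 4)⁻¹ * |((((N : ℕ) : ℝ) ^ 4) • colOf (KPerf (d := 3) Lc (sfStep Lc) (smStep 3 Lc) m)) c a (((N : ℕ) : ℤ) • (0 : Pt) - p)|
        ≤ (((N : ℕ) : ℝ) ^ 4)⁻¹ * (C * (((N : ℕ) : ℝ))⁻¹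
            * Real.exp (-(κ₀ / 4 / ((N : ℕ) : ℝ)) * (supNorm (p - ((N : ℕ) : ℤ) • (0 : Pt)) : ℝ))) :=
          mul_le_mul_of_nonneg_left h1 (by positivity)
      _ = _ := by ring
  · have hterm : ∀ u, (1 + ((supNorm (x - ((N : ℕ) : ℤ) • u) : ℝ) / ((N : ℕ) : ℝ)) ^ 2)
        * |colH (KPerf (d := 3) Lc (sfStep Lc) (smStep 3 Lc) m) N b u e x|
        = (((N : ℕ) : ℝ) ^ 4)⁻¹ * ((1 + ((supNorm (x - ((N : ℕ) : ℤ) • u) : ℝ) / ((N : ℕ) : ℝ)) ^ 2)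
          * |((((N : ℕ) : ℝ) ^ 4) • colOf (KPerf (d := 3) Lc (sfStep Lc) (smStep 3 Lc) m)) e b (((N : ℕ) : ℤ) • u - x)|) := by
      intro u
      rw [colH_eq_colOf_of_cov hcov, abs_colOf_eq_of_smul _ hNpos]
      ring
    rw [Finset.sum_congr rfl fun u _ => hterm u, ← Finset.mul_sum]
    have h2 := (hκl e b).2 x S'
    calc (((N : ℕ) : ℝ) ^ 4)⁻¹ * ∑ u ∈ S', (1 + ((supNorm (x - ((N : ℕ) : ℤ) • u) : ℝ) / ((N : ℕ) : ℝ)) ^ 2)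
          * |((((N : ℕ) : ℝ) ^ 4) • colOf (KPerf (d := 3) Lc (sfStep Lc) (smStep 3 Lc) m)) e b (((N : ℕ) : ℤ) • u - x)|
        ≤ (((N : ℕ) : ℝ) ^ 4)⁻¹ * (C * (((N : ℕ) : ℝ))⁻¹ * ((1 + 16 / (κ₀ / 4) ^ 2)
            * (Real.exp (κ₀ / 4 / 2) * (1 + 480 * Real.exp (κ₀ / 4 / 2 / 2) * (2 / (κ₀ / 4 / 2)) ^ 4)))) :=
          mul_le_mul_of_nonneg_left h2 (by positivity)
      _ = _ := by ring

end Summit.QuantumFields.BalabanUV.Beta.FP.PerfectColumnLettersColH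

end
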